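import Summits.QuantumFields.YangMills.Theorems.BalabanUVNodesN12AtRecord13OfResiduals
import Literature.MathematicalPhysics.QuantumFieldTheory.Balaban1983to89.Node00.N24NodesStage13FourPinPointedCo
import Literature.MathematicalPhysics.QuantumFieldTheory.Balaban1983to89.B16RLeafRecord13LiveCo

/-!
# BalabanUVNodes ∕ N12 — THE GENERIC-`W₀` FOUR-PIN SOCKETS AT THE Co CORE RECORD, N12 RESOLVED WITH THE MIXED W-PIN (AND N13 ON THE LIVE LINE): the thirteen-node pointed conclusion at a
# world bound to `(((θL.toStage5₁₃Co.pinB10).pinY (Y9OfRecord …)).pinZ (Z11OfRecord ζ)).pinW W₀` for ANY [IV] carrier family `W₀` agreeing with the bundle of record below the torus — N12's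
# row from its per-run displays there, the closer's degenerate carrier elsewhere (NO `K ≤ kSel P` leaf about the bundle of record); §2: N13's (R₁₃Co) row also fed by name (Track A, DAG node
# N12 = [B15, Balaban1989LargeFieldI] CMP **122** (1989) 175–202; cluster K1 (stmt-QuantumFields-20290 → K1⁵ at rev 20 on v1.5 `SepCoP`, director-ym №160); seat `pub-ymgap-dag-n12-d`
# (R134 s2), 2026-08-27; count-neutral, NOT a discharge)

HONEST FRAMING.  Count-neutral kernel COMPOSITION BY NAME over dag-n24-c's Co generic-`W₀` four-pin module `Node00/N24NodesStage13FourPinPointedCo` (`N24_nodes₁₃B10YZW₀_pointed_co`,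
`N24_endStatementBPrinted₁₃Co_fourPinW₀_pointed`, at node00-def-T FILE 21's Co core record `IsRecordOfRecord₁₃CCo` ∕ `datumOfRecord₁₃Co` keyed on the background-free `Provisos₁₃Core`,
director-ym №152 (β)), this seat's 12E (`b15Leaf_WOfRecord₁₃_liveRepin₁₃_of_massLive_of_hasResiduals`: N12's row at a live re-pin carrying node00-def-K0b's residuals from the (1.100)
pin equation + live-mass + Prop. 1 + (1.80) + (1.89)) and — §2 — dag-n11-e's Co live chain `B16RLeafRecord13LiveCo.laws₁₃Co_liveRepin₁₃_of_hasResiduals` (N13's (R₁₃Co) row at the live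
re-pin from admissibility + three signs).  Rows N05–N11, (UV₁₃) `hUV`, the world binding and N12's per-run displays are DISPLAYED hypotheses (§1 also displays N13's `hR`); nothing of
Bałaban's is asserted; N12 is NOT discharged; no node is discharged; counts unmoved (Track A discharged 5∕28).  EDITION NOTE (director-ym №160, pen's choice (5)(a)): a (β) `Co` sibling
filed now — its v1.5 `CoP` twin is a token swap once node00-def-T's FILE 23 `Record13CoP` and dag-n24-c's `…FourPinPointedCoP` land; the displayed N11 slot `h11` (S1ᵀ) is vacuous-as-typed
at step `k = 0` on editions ≤ v1.4 per pub-ymgap-dag-ref-D ADDENDUM-211 ∕ FINDING №7 (displayed, never consumed here; re-ranged at `CoP`).  ONE finite four-torus programme at fixed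
`ε = L^{-K}` — nothing continuum ∕ ℝ⁴ ∕ OS ∕ mass gap ∕ Clay.
-/

noncomputable section

open MeasureTheory
open scoped Matrix.Norms.L2Operator

namespace Summit.QuantumFields.YangMills.BalabanUVNodes.N12AtRecord13CoSockets

open Literature.MathematicalPhysics.QuantumFieldTheory.Balaban1983to89
open Literature.MathematicalPhysics.QuantumFieldTheory.Balaban1983to89.T4Continuum (T4Family)
open Literature.MathematicalPhysics.QuantumFieldTheory.Balaban1983to89.DagBinding
open Literature.MathematicalPhysics.QuantumFieldTheory.Balaban1983to89.Node00
open FlowStep (BetaLowerH BetaUpperH)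
open FlowStepRuns (genFlow)
open B15Claim189Assembly (new189 chiPP dom)
open B15 (Prop1Printed Ineq180)
open B15.BasicStep (Claim189)
open B8Eq17ClassAkV1 (plaqsOf)
open B15RPrime1100OfRep (rPrimeDataOfSel)
open Summit.QuantumFields.YangMills.BalabanUVNodes.N12AtRecord13OfResiduals (b15Leaf_WOfRecord₁₃_liveRepin₁₃_of_massLive_of_hasResiduals)
open B16RLeafRecord13LiveCo (laws₁₃Co_liveRepin₁₃_of_hasResiduals)

variable {N : ℕ} [NeZero N] {F : T4Family}

/-! ## §1. The generic-`W₀` four-pin sockets at the live re-pin, N12 resolved by the mixed W-pin (N13's `hR` displayed) -/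

section Live
variable (Θ : Stage13Params F N) (lamW : ResidW F N)

/-- **★ THE THIRTEEN NODES AT A WORLD BOUND TO THE GENERIC-`W₀` FOUR-PIN VIEW OF THE LIVE RE-PIN, N12 RESOLVED BY THE MIXED W-PIN** — dag-n24-c's `N24_nodes₁₃B10YZW₀_pointed_co` at
`θ := Θ.liveRepin₁₃` with its `h12 : ∀ P, B15Leaf (W₀ P)` SUPPLIED: on the runs with `λ.kSel P < P.K` by 12E's row at the bundle of record (`hW` rewrites `W₀ P` to it), on the other runs by
the closer's `hWdeg` (e.g. the degenerate carrier of g4 `exists_printedCarriers15_b15Leaf` — no printed basic step there).  Conclusion: the Co CORE record at `w` ∧ `∀ P, Nodes (leavesP w P)`.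
[cite: Balaban1989LargeFieldII, Thm 1 p.355, (0.1) pp.355–356; Balaban1989LargeFieldI, (0.1)–(0.6) pp.175–176, Prop. 1 (1.78) p.194, (1.80) p.195, (1.89) p.198, (1.99)–(1.102) pp.200–201; Balaban1988Convergent, (3.16)–(3.25) pp.268–270 (bookkeeping)] -/
theorem nodes₁₃B10YZW₀_pointed_co_liveRepin₁₃_of_massLive_of_hasResiduals (hres : Θ.HasResidualsOfRecord F N) (hP : (Θ.liveRepin₁₃ F N).Provisos₁₃Core F N) (hθ : Θ.Admissible F N)
    (Mstar : ℕ) (ops : OpsY N (Θ.liveRepin₁₃ F N).toStage3Params Mstar) (ζ : ResidZ F N) (W₀ : B12.RunParams → PrintedCarriers15) (w : WorldP)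
    -- the generic [IV] carrier family AGREES WITH THE BUNDLE OF RECORD on the runs whose selected step is a printed step, and carries the leaf elsewhere (closer: the degenerate carrier)
    (hW : ∀ P : B12.RunParams, lamW.kSel P < P.K → W₀ P = WOfRecord₁₃ F N (Θ.liveRepin₁₃ F N) lamW P) (hWdeg : ∀ P : B12.RunParams, P.K ≤ lamW.kSel P → B15Leaf (W₀ P))
    (hC : w.C = (datumOfRecord₁₃Co F N (Θ.liveRepin₁₃ F N) hP).C) (hγ : 0 < w.γ ∧ w.γ ≤ (Θ.liveRepin₁₃ F N).γ) (hL : w.L = ((Θ.liveRepin₁₃ F N).L : ℝ))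
    (hup : ∀ P, w.up P = upOfRecord₅C F N ((((((Θ.liveRepin₁₃ F N).toStage5₁₃Co F N).pinB10 F N).pinY F N (Y9OfRecord N (Θ.liveRepin₁₃ F N).toStage3Params Mstar ops)).pinZ F N (Z11OfRecord F N ζ)).pinW F N W₀) P)
    (h05 : ∀ P : B12.RunParams,
      B8LeafR ((Θ.liveRepin₁₃ F N).res.X P).d8 ((Θ.liveRepin₁₃ F N).res.X P).L8 ((Θ.liveRepin₁₃ F N).res.X P).C₂ ((Θ.liveRepin₁₃ F N).res.X P).B₁' ((Θ.liveRepin₁₃ F N).res.X P).B₀' ((Θ.liveRepin₁₃ F N).res.X P).B₁ ((Θ.liveRepin₁₃ F N).res.X P).B₂ ((Θ.liveRepin₁₃ F N).res.X P).c₁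
        ((Θ.liveRepin₁₃ F N).res.X P).inp8 ((Θ.liveRepin₁₃ F N).res.X P).B₀β ((Θ.liveRepin₁₃ F N).res.X P).loc8 ((Θ.liveRepin₁₃ F N).res.X P).fam8R ((Θ.liveRepin₁₃ F N).res.X P).lan8 ((Θ.liveRepin₁₃ F N).res.X P).cub8 ((Θ.liveRepin₁₃ F N).res.X P).toAxial8)
    (h06 : B9LeafX (Y9OfRecord N (Θ.liveRepin₁₃ F N).toStage3Params Mstar ops))
    (h07 : B11Leaf (Z11OfRecord F N ζ))
    (h08 : PrintedUV3V N (Θ.liveRepin₁₃ F N).L)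
    (h09 : ∀ P : B12.RunParams, B12Sec2to5.Lemma4Printed ((Θ.liveRepin₁₃ F N).res.X P).F12 ((Θ.liveRepin₁₃ F N).res.X P).c12)
    (h09T : ∀ P : B12.RunParams, (leavesP w P).smallCouplings → (leavesP w P).smallFieldInductive)
    (h10 : ∀ P : B12.RunParams, B9LeafX (Y9OfRecord N (Θ.liveRepin₁₃ F N).toStage3Params Mstar ops) →
      (B10.Thm1PrintedCompact (((((((Θ.liveRepin₁₃ F N).toStage5₁₃Co F N).pinB10 F N).pinY F N (Y9OfRecord N (Θ.liveRepin₁₃ F N).toStage3Params Mstar ops)).pinZ F N (Z11OfRecord F N ζ)).pinW F N W₀).res.X P).runs10 ∧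
          B10.Thm2Printed (((((((Θ.liveRepin₁₃ F N).toStage5₁₃Co F N).pinB10 F N).pinY F N (Y9OfRecord N (Θ.liveRepin₁₃ F N).toStage3Params Mstar ops)).pinZ F N (Z11OfRecord F N ζ)).pinW F N W₀).res.X P).runs10) →
        B11Leaf (Z11OfRecord F N ζ) → B12Sec2to5.Lemma4Printed ((Θ.liveRepin₁₃ F N).res.X P).F12 ((Θ.liveRepin₁₃ F N).res.X P).c12 →
          B13.Lemma1Printed ((Θ.liveRepin₁₃ F N).res.X P).S13 ((Θ.liveRepin₁₃ F N).res.X P).c13 ∧ B13.Lemma2Printed ((Θ.liveRepin₁₃ F N).res.X P).S13 ((Θ.liveRepin₁₃ F N).res.X P).c13 ∧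
            B13.Lemma3Printed ((Θ.liveRepin₁₃ F N).res.X P).S13 ((Θ.liveRepin₁₃ F N).res.X P).c13)
    (h11 : ∀ P : B12.RunParams, (leavesP w P).b7 → (leavesP w P).b8 → (leavesP w P).b9 → (leavesP w P).b10 → (leavesP w P).b11 →
      (leavesP w P).smallCouplings → (leavesP w P).smallFieldInductive → (leavesP w P).flowControl →
        ∀ k, k < P.K → SLaw₁₃Co F N (Θ.liveRepin₁₃ F N) P k → TLaw₁₃Co F N (Θ.liveRepin₁₃ F N) P k)
    -- N12's displays, run by run, BELOW THE TORUS ONLY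
    (h12pin : ∀ P : B12.RunParams, lamW.kSel P < P.K → lamW.D1100 P
      = rPrimeDataOfSel (reprTOfRecord₁₃ F N (Θ.liveRepin₁₃ F N) P (lamW.kSel P))
          ((Θ.liveRepin₁₃ F N).ppSel P (gOfRecord₁₃ F N (Θ.liveRepin₁₃ F N) P) (lamW.kSel P + 1))
          (fibOfSeq F (Θ.liveRepin₁₃ F N).ν (Θ.liveRepin₁₃ F N).τ9 P (gOfRecord₁₃ F N (Θ.liveRepin₁₃ F N) P) (lamW.kSel P + 1)))
    (h12mass : ∀ P : B12.RunParams, lamW.kSel P < P.K → ∀ s, LiveSeq F N Θ.ν Θ.τ9 P (gOfRecord₁₃ F N (Θ.liveRepin₁₃ F N) P) (lamW.kSel P + 1)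
        (slotsTOfRecord F N Θ.ν Θ.τ9 (EOfRecord₁₃ F N (Θ.liveRepin₁₃ F N)) (wOfRecord₉ F N (Θ.liveRepin₁₃ F N).toStage9Params)
          (Θ.liveRepin₁₃ F N).ppSel P (gOfRecord₁₃ F N (Θ.liveRepin₁₃ F N) P) (lamW.kSel P + 1)) s →
      0 < ∫ V, rterm (reprTOfRecord₁₃ F N (Θ.liveRepin₁₃ F N) P (lamW.kSel P)) s V ∂(fieldMeasure (F.P P.K) (lamW.kSel P + 1) (SU N)))
    (h12P1 : ∀ P : B12.RunParams, lamW.kSel P < P.K → Prop1Printed (lamW.LF P))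
    (h12i180 : ∀ P : B12.RunParams, lamW.kSel P < P.K → ∀ U, new189 (lamW.D189 P) U → ∀ i, (lamW.D189 P).h ≤ i → i ≤ (lamW.D189 P).k →
      ∀ q ∈ plaqsOf (dom (lamW.D189 P) i),
        Ineq180 ((lamW.D189 P).dev0 U q) ((lamW.D189 P).ε (lamW.D189 P).k) (lamW.D189 P).η (lamW.D189 P).B₃ (lamW.D189 P).B₅ (lamW.D189 P).M (lamW.D189 P).δ
          ((lamW.D189 P).dist q) (lamW.D189 P).O1)
    (h12c189 : ∀ P : B12.RunParams, lamW.kSel P < P.K → Claim189 (new189 (lamW.D189 P)) (chiPP (lamW.D189 P)))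
    (hR : ∀ (P : B12.RunParams) (k : ℕ), k < P.K → TLaw₁₃Co F N (Θ.liveRepin₁₃ F N) P k → SLaw₁₃Co F N (Θ.liveRepin₁₃ F N) P (k + 1))
    (hUV : ∀ P : B12.RunParams, (genFlow (betaOfRecord₁₃ F N (Θ.liveRepin₁₃ F N)) P.g0).InInterval w.γ P.K → ∀ k, k ≤ P.K → SLaw₁₃Co F N (Θ.liveRepin₁₃ F N) P k →
      ∀ U : GaugeField (F.P P.K) k (SU N),
        chiβOfRecord₁₃ F N (Θ.liveRepin₁₃ F N) P.K (gOfRecord₁₃ F N (Θ.liveRepin₁₃ F N) P) k U *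
              Real.exp (-(1 / (gOfRecord₁₃ F N (Θ.liveRepin₁₃ F N) P k) ^ 2 * wilsonBGOfRecord F N (Θ.liveRepin₁₃ F N).εbg P k U)
                - w.em (gOfRecord₁₃ F N (Θ.liveRepin₁₃ F N) P k) * (Fintype.card (Site (F.P P.K) k) : ℝ)) ≤ densOfRecord₁₃ F N (Θ.liveRepin₁₃ F N) P k U ∧
        densOfRecord₁₃ F N (Θ.liveRepin₁₃ F N) P k U ≤ Real.exp (w.ep (gOfRecord₁₃ F N (Θ.liveRepin₁₃ F N) P k) * (Fintype.card (Site (F.P P.K) k) : ℝ))) :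
    IsRecordOfRecord₁₃CCo F N (datumOfRecord₁₃Co F N (Θ.liveRepin₁₃ F N) hP) w ∧ ∀ P : B12.RunParams, Nodes (leavesP w P) :=
  N24_nodes₁₃B10YZW₀_pointed_co (Θ.liveRepin₁₃ F N) hP hθ.liveRepin₁₃ Mstar ops ζ W₀ w hC hγ hL hup h05 h06 h07 h08 h09 h09T h10 h11
    (fun P => by
      by_cases hk : lamW.kSel P < P.K
      · rw [hW P hk]
        exact b15Leaf_WOfRecord₁₃_liveRepin₁₃_of_massLive_of_hasResiduals Θ lamW hres hk (h12pin P hk) (h12mass P hk) (h12P1 P hk) (h12i180 P hk) (h12c189 P hk)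
      · exact hWdeg P (not_lt.1 hk))
    hR hUV


/-- **★ (B2) AT THE Co DATUM OF THE LIVE RE-PIN OVER THE GENERIC-`W₀` FOUR-PIN VIEW, N12 RESOLVED BY THE MIXED W-PIN** — dag-n24-c's `N24_endStatementBPrinted₁₃Co_fourPinW₀_pointed` at
`θ := Θ.liveRepin₁₃`, its `h12` supplied as in the previous theorem; the β-box pair `hlo ∕ hhi` on `(datumOfRecord₁₃Co …).βfun = betaOfRecord₁₃ θL` (`rfl`) displayed (it is also the home of
12N's β-sign leaf).  COMPOSITE: nothing is discharged. [cite: Balaban1989LargeFieldII, Thm 1 p.355, (0.1) pp.355–356, p.391; Balaban1989LargeFieldI, (0.2)–(0.6) p.176, Prop. 1 (1.78) p.194, (1.80) p.195, (1.89) p.198; Balaban1987RG1, Thm 3 p.264, (1.22) p.264 (bookkeeping)] -/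
theorem endStatementBPrinted₁₃Co_fourPinW₀_liveRepin₁₃_of_massLive_of_hasResiduals (hres : Θ.HasResidualsOfRecord F N) (hP : (Θ.liveRepin₁₃ F N).Provisos₁₃Core F N) (hθ : Θ.Admissible F N)
    (Mstar : ℕ) (ops : OpsY N (Θ.liveRepin₁₃ F N).toStage3Params Mstar) (ζ : ResidZ F N) (W₀ : B12.RunParams → PrintedCarriers15) (w : WorldP)
    (hW : ∀ P : B12.RunParams, lamW.kSel P < P.K → W₀ P = WOfRecord₁₃ F N (Θ.liveRepin₁₃ F N) lamW P) (hWdeg : ∀ P : B12.RunParams, P.K ≤ lamW.kSel P → B15Leaf (W₀ P))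
    (hC : w.C = (datumOfRecord₁₃Co F N (Θ.liveRepin₁₃ F N) hP).C) (hγ : 0 < w.γ ∧ w.γ ≤ (Θ.liveRepin₁₃ F N).γ) (hL : w.L = ((Θ.liveRepin₁₃ F N).L : ℝ))
    (hup : ∀ P, w.up P = upOfRecord₅C F N ((((((Θ.liveRepin₁₃ F N).toStage5₁₃Co F N).pinB10 F N).pinY F N (Y9OfRecord N (Θ.liveRepin₁₃ F N).toStage3Params Mstar ops)).pinZ F N (Z11OfRecord F N ζ)).pinW F N W₀) P)
    (h05 : ∀ P : B12.RunParams,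
      B8LeafR ((Θ.liveRepin₁₃ F N).res.X P).d8 ((Θ.liveRepin₁₃ F N).res.X P).L8 ((Θ.liveRepin₁₃ F N).res.X P).C₂ ((Θ.liveRepin₁₃ F N).res.X P).B₁' ((Θ.liveRepin₁₃ F N).res.X P).B₀' ((Θ.liveRepin₁₃ F N).res.X P).B₁ ((Θ.liveRepin₁₃ F N).res.X P).B₂ ((Θ.liveRepin₁₃ F N).res.X P).c₁
        ((Θ.liveRepin₁₃ F N).res.X P).inp8 ((Θ.liveRepin₁₃ F N).res.X P).B₀β ((Θ.liveRepin₁₃ F N).res.X P).loc8 ((Θ.liveRepin₁₃ F N).res.X P).fam8R ((Θ.liveRepin₁₃ F N).res.X P).lan8 ((Θ.liveRepin₁₃ F N).res.X P).cub8 ((Θ.liveRepin₁₃ F N).res.X P).toAxial8)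
    (h06 : B9LeafX (Y9OfRecord N (Θ.liveRepin₁₃ F N).toStage3Params Mstar ops))
    (h07 : B11Leaf (Z11OfRecord F N ζ))
    (h08 : PrintedUV3V N (Θ.liveRepin₁₃ F N).L)
    (h09 : ∀ P : B12.RunParams, B12Sec2to5.Lemma4Printed ((Θ.liveRepin₁₃ F N).res.X P).F12 ((Θ.liveRepin₁₃ F N).res.X P).c12)
    (h09T : ∀ P : B12.RunParams, (leavesP w P).smallCouplings → (leavesP w P).smallFieldInductive)
    (h10 : ∀ P : B12.RunParams, B9LeafX (Y9OfRecord N (Θ.liveRepin₁₃ F N).toStage3Params Mstar ops) →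
      (B10.Thm1PrintedCompact (((((((Θ.liveRepin₁₃ F N).toStage5₁₃Co F N).pinB10 F N).pinY F N (Y9OfRecord N (Θ.liveRepin₁₃ F N).toStage3Params Mstar ops)).pinZ F N (Z11OfRecord F N ζ)).pinW F N W₀).res.X P).runs10 ∧
          B10.Thm2Printed (((((((Θ.liveRepin₁₃ F N).toStage5₁₃Co F N).pinB10 F N).pinY F N (Y9OfRecord N (Θ.liveRepin₁₃ F N).toStage3Params Mstar ops)).pinZ F N (Z11OfRecord F N ζ)).pinW F N W₀).res.X P).runs10) →
        B11Leaf (Z11OfRecord F N ζ) → B12Sec2to5.Lemma4Printed ((Θ.liveRepin₁₃ F N).res.X P).F12 ((Θ.liveRepin₁₃ F N).res.X P).c12 →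
          B13.Lemma1Printed ((Θ.liveRepin₁₃ F N).res.X P).S13 ((Θ.liveRepin₁₃ F N).res.X P).c13 ∧ B13.Lemma2Printed ((Θ.liveRepin₁₃ F N).res.X P).S13 ((Θ.liveRepin₁₃ F N).res.X P).c13 ∧
            B13.Lemma3Printed ((Θ.liveRepin₁₃ F N).res.X P).S13 ((Θ.liveRepin₁₃ F N).res.X P).c13)
    (h11 : ∀ P : B12.RunParams, (leavesP w P).b7 → (leavesP w P).b8 → (leavesP w P).b9 → (leavesP w P).b10 → (leavesP w P).b11 →
      (leavesP w P).smallCouplings → (leavesP w P).smallFieldInductive → (leavesP w P).flowControl →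
        ∀ k, k < P.K → SLaw₁₃Co F N (Θ.liveRepin₁₃ F N) P k → TLaw₁₃Co F N (Θ.liveRepin₁₃ F N) P k)
    (h12pin : ∀ P : B12.RunParams, lamW.kSel P < P.K → lamW.D1100 P
      = rPrimeDataOfSel (reprTOfRecord₁₃ F N (Θ.liveRepin₁₃ F N) P (lamW.kSel P))
          ((Θ.liveRepin₁₃ F N).ppSel P (gOfRecord₁₃ F N (Θ.liveRepin₁₃ F N) P) (lamW.kSel P + 1))
          (fibOfSeq F (Θ.liveRepin₁₃ F N).ν (Θ.liveRepin₁₃ F N).τ9 P (gOfRecord₁₃ F N (Θ.liveRepin₁₃ F N) P) (lamW.kSel P + 1)))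
    (h12mass : ∀ P : B12.RunParams, lamW.kSel P < P.K → ∀ s, LiveSeq F N Θ.ν Θ.τ9 P (gOfRecord₁₃ F N (Θ.liveRepin₁₃ F N) P) (lamW.kSel P + 1)
        (slotsTOfRecord F N Θ.ν Θ.τ9 (EOfRecord₁₃ F N (Θ.liveRepin₁₃ F N)) (wOfRecord₉ F N (Θ.liveRepin₁₃ F N).toStage9Params)
          (Θ.liveRepin₁₃ F N).ppSel P (gOfRecord₁₃ F N (Θ.liveRepin₁₃ F N) P) (lamW.kSel P + 1)) s →
      0 < ∫ V, rterm (reprTOfRecord₁₃ F N (Θ.liveRepin₁₃ F N) P (lamW.kSel P)) s V ∂(fieldMeasure (F.P P.K) (lamW.kSel P + 1) (SU N)))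
    (h12P1 : ∀ P : B12.RunParams, lamW.kSel P < P.K → Prop1Printed (lamW.LF P))
    (h12i180 : ∀ P : B12.RunParams, lamW.kSel P < P.K → ∀ U, new189 (lamW.D189 P) U → ∀ i, (lamW.D189 P).h ≤ i → i ≤ (lamW.D189 P).k →
      ∀ q ∈ plaqsOf (dom (lamW.D189 P) i),
        Ineq180 ((lamW.D189 P).dev0 U q) ((lamW.D189 P).ε (lamW.D189 P).k) (lamW.D189 P).η (lamW.D189 P).B₃ (lamW.D189 P).B₅ (lamW.D189 P).M (lamW.D189 P).δ
          ((lamW.D189 P).dist q) (lamW.D189 P).O1)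
    (h12c189 : ∀ P : B12.RunParams, lamW.kSel P < P.K → Claim189 (new189 (lamW.D189 P)) (chiPP (lamW.D189 P)))
    (hR : ∀ (P : B12.RunParams) (k : ℕ), k < P.K → TLaw₁₃Co F N (Θ.liveRepin₁₃ F N) P k → SLaw₁₃Co F N (Θ.liveRepin₁₃ F N) P (k + 1))
    (hUV : ∀ P : B12.RunParams, (genFlow (betaOfRecord₁₃ F N (Θ.liveRepin₁₃ F N)) P.g0).InInterval w.γ P.K → ∀ k, k ≤ P.K → SLaw₁₃Co F N (Θ.liveRepin₁₃ F N) P k →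
      ∀ U : GaugeField (F.P P.K) k (SU N),
        chiβOfRecord₁₃ F N (Θ.liveRepin₁₃ F N) P.K (gOfRecord₁₃ F N (Θ.liveRepin₁₃ F N) P) k U *
              Real.exp (-(1 / (gOfRecord₁₃ F N (Θ.liveRepin₁₃ F N) P k) ^ 2 * wilsonBGOfRecord F N (Θ.liveRepin₁₃ F N).εbg P k U)
                - w.em (gOfRecord₁₃ F N (Θ.liveRepin₁₃ F N) P k) * (Fintype.card (Site (F.P P.K) k) : ℝ)) ≤ densOfRecord₁₃ F N (Θ.liveRepin₁₃ F N) P k U ∧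
        densOfRecord₁₃ F N (Θ.liveRepin₁₃ F N) P k U ≤ Real.exp (w.ep (gOfRecord₁₃ F N (Θ.liveRepin₁₃ F N) P k) * (Fintype.card (Site (F.P P.K) k) : ℝ)))
    (hlo : BetaLowerH w.b w.γ (datumOfRecord₁₃Co F N (Θ.liveRepin₁₃ F N) hP).βfun) (hhi : BetaUpperH w.βup w.γ (datumOfRecord₁₃Co F N (Θ.liveRepin₁₃ F N) hP).βfun) :
    B16.EndStatementBPrinted (datumOfRecord₁₃Co F N (Θ.liveRepin₁₃ F N) hP).C :=
  N24_endStatementBPrinted₁₃Co_fourPinW₀_pointed (Θ.liveRepin₁₃ F N) hP hθ.liveRepin₁₃ Mstar ops ζ W₀ w hC hγ hL hup h05 h06 h07 h08 h09 h09T h10 h11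
    (fun P => by
      by_cases hk : lamW.kSel P < P.K
      · rw [hW P hk]
        exact b15Leaf_WOfRecord₁₃_liveRepin₁₃_of_massLive_of_hasResiduals Θ lamW hres hk (h12pin P hk) (h12mass P hk) (h12P1 P hk) (h12i180 P hk) (h12c189 P hk)
      · exact hWdeg P (not_lt.1 hk))
    hR hUV hlo hhi

end Live

/-! ## §2. The same two sockets with N13's (R₁₃Co) row discharged by dag-n11-e's Co live chain (`laws₁₃Co_liveRepin₁₃_of_hasResiduals`) -/

section LiveR
variable (Θ : Stage13Params F N) (lamW : ResidW F N)

/-- **★★ THE SAME SOCKET WITH N13's (R₁₃Co) ROW ALSO DISCHARGED ON THE LIVE LINE** — the previous theorem with its displayed `hR` slot FED by dag-n11-e's Co live chain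
`B16RLeafRecord13LiveCo.laws₁₃Co_liveRepin₁₃_of_hasResiduals` (the 𝐑-leaf in law form at the live re-pin of any `Θ` carrying node00-def-K0b's residuals; inputs: admissibility and the
three term-constant signs `0 ≤ κ, E₀, B₀` of `Θ.s2.lf`).  So at this socket N12 (below the torus: pin equation + live-mass + Prop. 1 + (1.80) + (1.89); elsewhere the closer's carrier) AND
N13 are supplied BY NAME; rows N05–N11, (UV₁₃) and the world binding stay displayed.  COMPOSITE ∕ count-neutral: no node is discharged by this file.
[cite: Balaban1989LargeFieldII, Thm 1 p.355, (0.1) pp.355–356; Balaban1989LargeFieldI, (0.1)–(0.6) pp.175–176, p.177 (i)–(ii), Prop. 1 (1.78) p.194, (1.80) p.195, (1.89) p.198, (1.99)–(1.102) pp.200–201; Balaban1988Convergent, p.244, (3.16)–(3.25) pp.268–270 (bookkeeping)] -/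
theorem nodes₁₃B10YZW₀_pointed_co_liveRepin₁₃_of_massLive_of_hasResiduals_of_signs (hres : Θ.HasResidualsOfRecord F N) (hP : (Θ.liveRepin₁₃ F N).Provisos₁₃Core F N) (hθ : Θ.Admissible F N)
    (hκ : 0 ≤ Θ.s2.lf.κ) (hE₀ : 0 ≤ Θ.s2.lf.E₀) (hB₀ : 0 ≤ Θ.s2.lf.B₀)
    (Mstar : ℕ) (ops : OpsY N (Θ.liveRepin₁₃ F N).toStage3Params Mstar) (ζ : ResidZ F N) (W₀ : B12.RunParams → PrintedCarriers15) (w : WorldP)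
    -- the generic [IV] carrier family AGREES WITH THE BUNDLE OF RECORD on the runs whose selected step is a printed step, and carries the leaf elsewhere (closer: the degenerate carrier)
    (hW : ∀ P : B12.RunParams, lamW.kSel P < P.K → W₀ P = WOfRecord₁₃ F N (Θ.liveRepin₁₃ F N) lamW P) (hWdeg : ∀ P : B12.RunParams, P.K ≤ lamW.kSel P → B15Leaf (W₀ P))
    (hC : w.C = (datumOfRecord₁₃Co F N (Θ.liveRepin₁₃ F N) hP).C) (hγ : 0 < w.γ ∧ w.γ ≤ (Θ.liveRepin₁₃ F N).γ) (hL : w.L = ((Θ.liveRepin₁₃ F N).L : ℝ))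
    (hup : ∀ P, w.up P = upOfRecord₅C F N ((((((Θ.liveRepin₁₃ F N).toStage5₁₃Co F N).pinB10 F N).pinY F N (Y9OfRecord N (Θ.liveRepin₁₃ F N).toStage3Params Mstar ops)).pinZ F N (Z11OfRecord F N ζ)).pinW F N W₀) P)
    (h05 : ∀ P : B12.RunParams,
      B8LeafR ((Θ.liveRepin₁₃ F N).res.X P).d8 ((Θ.liveRepin₁₃ F N).res.X P).L8 ((Θ.liveRepin₁₃ F N).res.X P).C₂ ((Θ.liveRepin₁₃ F N).res.X P).B₁' ((Θ.liveRepin₁₃ F N).res.X P).B₀' ((Θ.liveRepin₁₃ F N).res.X P).B₁ ((Θ.liveRepin₁₃ F N).res.X P).B₂ ((Θ.liveRepin₁₃ F N).res.X P).c₁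
        ((Θ.liveRepin₁₃ F N).res.X P).inp8 ((Θ.liveRepin₁₃ F N).res.X P).B₀β ((Θ.liveRepin₁₃ F N).res.X P).loc8 ((Θ.liveRepin₁₃ F N).res.X P).fam8R ((Θ.liveRepin₁₃ F N).res.X P).lan8 ((Θ.liveRepin₁₃ F N).res.X P).cub8 ((Θ.liveRepin₁₃ F N).res.X P).toAxial8)
    (h06 : B9LeafX (Y9OfRecord N (Θ.liveRepin₁₃ F N).toStage3Params Mstar ops))
    (h07 : B11Leaf (Z11OfRecord F N ζ))
    (h08 : PrintedUV3V N (Θ.liveRepin₁₃ F N).L)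
    (h09 : ∀ P : B12.RunParams, B12Sec2to5.Lemma4Printed ((Θ.liveRepin₁₃ F N).res.X P).F12 ((Θ.liveRepin₁₃ F N).res.X P).c12)
    (h09T : ∀ P : B12.RunParams, (leavesP w P).smallCouplings → (leavesP w P).smallFieldInductive)
    (h10 : ∀ P : B12.RunParams, B9LeafX (Y9OfRecord N (Θ.liveRepin₁₃ F N).toStage3Params Mstar ops) →
      (B10.Thm1PrintedCompact (((((((Θ.liveRepin₁₃ F N).toStage5₁₃Co F N).pinB10 F N).pinY F N (Y9OfRecord N (Θ.liveRepin₁₃ F N).toStage3Params Mstar ops)).pinZ F N (Z11OfRecord F N ζ)).pinW F N W₀).res.X P).runs10 ∧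
          B10.Thm2Printed (((((((Θ.liveRepin₁₃ F N).toStage5₁₃Co F N).pinB10 F N).pinY F N (Y9OfRecord N (Θ.liveRepin₁₃ F N).toStage3Params Mstar ops)).pinZ F N (Z11OfRecord F N ζ)).pinW F N W₀).res.X P).runs10) →
        B11Leaf (Z11OfRecord F N ζ) → B12Sec2to5.Lemma4Printed ((Θ.liveRepin₁₃ F N).res.X P).F12 ((Θ.liveRepin₁₃ F N).res.X P).c12 →
          B13.Lemma1Printed ((Θ.liveRepin₁₃ F N).res.X P).S13 ((Θ.liveRepin₁₃ F N).res.X P).c13 ∧ B13.Lemma2Printed ((Θ.liveRepin₁₃ F N).res.X P).S13 ((Θ.liveRepin₁₃ F N).res.X P).c13 ∧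
            B13.Lemma3Printed ((Θ.liveRepin₁₃ F N).res.X P).S13 ((Θ.liveRepin₁₃ F N).res.X P).c13)
    (h11 : ∀ P : B12.RunParams, (leavesP w P).b7 → (leavesP w P).b8 → (leavesP w P).b9 → (leavesP w P).b10 → (leavesP w P).b11 →
      (leavesP w P).smallCouplings → (leavesP w P).smallFieldInductive → (leavesP w P).flowControl →
        ∀ k, k < P.K → SLaw₁₃Co F N (Θ.liveRepin₁₃ F N) P k → TLaw₁₃Co F N (Θ.liveRepin₁₃ F N) P k)
    -- N12's displays, run by run, BELOW THE TORUS ONLY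
    (h12pin : ∀ P : B12.RunParams, lamW.kSel P < P.K → lamW.D1100 P
      = rPrimeDataOfSel (reprTOfRecord₁₃ F N (Θ.liveRepin₁₃ F N) P (lamW.kSel P))
          ((Θ.liveRepin₁₃ F N).ppSel P (gOfRecord₁₃ F N (Θ.liveRepin₁₃ F N) P) (lamW.kSel P + 1))
          (fibOfSeq F (Θ.liveRepin₁₃ F N).ν (Θ.liveRepin₁₃ F N).τ9 P (gOfRecord₁₃ F N (Θ.liveRepin₁₃ F N) P) (lamW.kSel P + 1)))
    (h12mass : ∀ P : B12.RunParams, lamW.kSel P < P.K → ∀ s, LiveSeq F N Θ.ν Θ.τ9 P (gOfRecord₁₃ F N (Θ.liveRepin₁₃ F N) P) (lamW.kSel P + 1)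
        (slotsTOfRecord F N Θ.ν Θ.τ9 (EOfRecord₁₃ F N (Θ.liveRepin₁₃ F N)) (wOfRecord₉ F N (Θ.liveRepin₁₃ F N).toStage9Params)
          (Θ.liveRepin₁₃ F N).ppSel P (gOfRecord₁₃ F N (Θ.liveRepin₁₃ F N) P) (lamW.kSel P + 1)) s →
      0 < ∫ V, rterm (reprTOfRecord₁₃ F N (Θ.liveRepin₁₃ F N) P (lamW.kSel P)) s V ∂(fieldMeasure (F.P P.K) (lamW.kSel P + 1) (SU N)))
    (h12P1 : ∀ P : B12.RunParams, lamW.kSel P < P.K → Prop1Printed (lamW.LF P))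
    (h12i180 : ∀ P : B12.RunParams, lamW.kSel P < P.K → ∀ U, new189 (lamW.D189 P) U → ∀ i, (lamW.D189 P).h ≤ i → i ≤ (lamW.D189 P).k →
      ∀ q ∈ plaqsOf (dom (lamW.D189 P) i),
        Ineq180 ((lamW.D189 P).dev0 U q) ((lamW.D189 P).ε (lamW.D189 P).k) (lamW.D189 P).η (lamW.D189 P).B₃ (lamW.D189 P).B₅ (lamW.D189 P).M (lamW.D189 P).δ
          ((lamW.D189 P).dist q) (lamW.D189 P).O1)
    (h12c189 : ∀ P : B12.RunParams, lamW.kSel P < P.K → Claim189 (new189 (lamW.D189 P)) (chiPP (lamW.D189 P)))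
    (hUV : ∀ P : B12.RunParams, (genFlow (betaOfRecord₁₃ F N (Θ.liveRepin₁₃ F N)) P.g0).InInterval w.γ P.K → ∀ k, k ≤ P.K → SLaw₁₃Co F N (Θ.liveRepin₁₃ F N) P k →
      ∀ U : GaugeField (F.P P.K) k (SU N),
        chiβOfRecord₁₃ F N (Θ.liveRepin₁₃ F N) P.K (gOfRecord₁₃ F N (Θ.liveRepin₁₃ F N) P) k U *
              Real.exp (-(1 / (gOfRecord₁₃ F N (Θ.liveRepin₁₃ F N) P k) ^ 2 * wilsonBGOfRecord F N (Θ.liveRepin₁₃ F N).εbg P k U)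
                - w.em (gOfRecord₁₃ F N (Θ.liveRepin₁₃ F N) P k) * (Fintype.card (Site (F.P P.K) k) : ℝ)) ≤ densOfRecord₁₃ F N (Θ.liveRepin₁₃ F N) P k U ∧
        densOfRecord₁₃ F N (Θ.liveRepin₁₃ F N) P k U ≤ Real.exp (w.ep (gOfRecord₁₃ F N (Θ.liveRepin₁₃ F N) P k) * (Fintype.card (Site (F.P P.K) k) : ℝ))) :
    IsRecordOfRecord₁₃CCo F N (datumOfRecord₁₃Co F N (Θ.liveRepin₁₃ F N) hP) w ∧ ∀ P : B12.RunParams, Nodes (leavesP w P) :=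
  N24_nodes₁₃B10YZW₀_pointed_co (Θ.liveRepin₁₃ F N) hP hθ.liveRepin₁₃ Mstar ops ζ W₀ w hC hγ hL hup h05 h06 h07 h08 h09 h09T h10 h11
    (fun P => by
      by_cases hk : lamW.kSel P < P.K
      · rw [hW P hk]
        exact b15Leaf_WOfRecord₁₃_liveRepin₁₃_of_massLive_of_hasResiduals Θ lamW hres hk (h12pin P hk) (h12mass P hk) (h12P1 P hk) (h12i180 P hk) (h12c189 P hk)
      · exact hWdeg P (not_lt.1 hk))
    (fun P => laws₁₃Co_liveRepin₁₃_of_hasResiduals F N Θ P hres hθ hκ hE₀ hB₀) hUV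

/-- **★★ (B2) AT THE Co DATUM OF THE LIVE RE-PIN, N12 AND N13 RESOLVED** — the previous (B2) socket with `hR` fed by `B16RLeafRecord13LiveCo.laws₁₃Co_liveRepin₁₃_of_hasResiduals`
(signs `hκ hE₀ hB₀` displayed); the β-box pair displayed.  COMPOSITE: nothing is discharged. [cite: Balaban1989LargeFieldII, Thm 1 p.355, (0.1) pp.355–356, p.391; Balaban1989LargeFieldI, (0.2)–(0.6) p.176, Prop. 1 (1.78) p.194, (1.80) p.195, (1.89) p.198; Balaban1988Convergent, p.244; Balaban1987RG1, Thm 3 p.264, (1.22) p.264 (bookkeeping)] -/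
theorem endStatementBPrinted₁₃Co_fourPinW₀_liveRepin₁₃_of_massLive_of_hasResiduals_of_signs (hres : Θ.HasResidualsOfRecord F N) (hP : (Θ.liveRepin₁₃ F N).Provisos₁₃Core F N) (hθ : Θ.Admissible F N)
    (hκ : 0 ≤ Θ.s2.lf.κ) (hE₀ : 0 ≤ Θ.s2.lf.E₀) (hB₀ : 0 ≤ Θ.s2.lf.B₀)
    (Mstar : ℕ) (ops : OpsY N (Θ.liveRepin₁₃ F N).toStage3Params Mstar) (ζ : ResidZ F N) (W₀ : B12.RunParams → PrintedCarriers15) (w : WorldP)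
    (hW : ∀ P : B12.RunParams, lamW.kSel P < P.K → W₀ P = WOfRecord₁₃ F N (Θ.liveRepin₁₃ F N) lamW P) (hWdeg : ∀ P : B12.RunParams, P.K ≤ lamW.kSel P → B15Leaf (W₀ P))
    (hC : w.C = (datumOfRecord₁₃Co F N (Θ.liveRepin₁₃ F N) hP).C) (hγ : 0 < w.γ ∧ w.γ ≤ (Θ.liveRepin₁₃ F N).γ) (hL : w.L = ((Θ.liveRepin₁₃ F N).L : ℝ))
    (hup : ∀ P, w.up P = upOfRecord₅C F N ((((((Θ.liveRepin₁₃ F N).toStage5₁₃Co F N).pinB10 F N).pinY F N (Y9OfRecord N (Θ.liveRepin₁₃ F N).toStage3Params Mstar ops)).pinZ F N (Z11OfRecord F N ζ)).pinW F N W₀) P)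
    (h05 : ∀ P : B12.RunParams,
      B8LeafR ((Θ.liveRepin₁₃ F N).res.X P).d8 ((Θ.liveRepin₁₃ F N).res.X P).L8 ((Θ.liveRepin₁₃ F N).res.X P).C₂ ((Θ.liveRepin₁₃ F N).res.X P).B₁' ((Θ.liveRepin₁₃ F N).res.X P).B₀' ((Θ.liveRepin₁₃ F N).res.X P).B₁ ((Θ.liveRepin₁₃ F N).res.X P).B₂ ((Θ.liveRepin₁₃ F N).res.X P).c₁
        ((Θ.liveRepin₁₃ F N).res.X P).inp8 ((Θ.liveRepin₁₃ F N).res.X P).B₀β ((Θ.liveRepin₁₃ F N).res.X P).loc8 ((Θ.liveRepin₁₃ F N).res.X P).fam8R ((Θ.liveRepin₁₃ F N).res.X P).lan8 ((Θ.liveRepin₁₃ F N).res.X P).cub8 ((Θ.liveRepin₁₃ F N).res.X P).toAxial8)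
    (h06 : B9LeafX (Y9OfRecord N (Θ.liveRepin₁₃ F N).toStage3Params Mstar ops))
    (h07 : B11Leaf (Z11OfRecord F N ζ))
    (h08 : PrintedUV3V N (Θ.liveRepin₁₃ F N).L)
    (h09 : ∀ P : B12.RunParams, B12Sec2to5.Lemma4Printed ((Θ.liveRepin₁₃ F N).res.X P).F12 ((Θ.liveRepin₁₃ F N).res.X P).c12)
    (h09T : ∀ P : B12.RunParams, (leavesP w P).smallCouplings → (leavesP w P).smallFieldInductive)
    (h10 : ∀ P : B12.RunParams, B9LeafX (Y9OfRecord N (Θ.liveRepin₁₃ F N).toStage3Params Mstar ops) →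
      (B10.Thm1PrintedCompact (((((((Θ.liveRepin₁₃ F N).toStage5₁₃Co F N).pinB10 F N).pinY F N (Y9OfRecord N (Θ.liveRepin₁₃ F N).toStage3Params Mstar ops)).pinZ F N (Z11OfRecord F N ζ)).pinW F N W₀).res.X P).runs10 ∧
          B10.Thm2Printed (((((((Θ.liveRepin₁₃ F N).toStage5₁₃Co F N).pinB10 F N).pinY F N (Y9OfRecord N (Θ.liveRepin₁₃ F N).toStage3Params Mstar ops)).pinZ F N (Z11OfRecord F N ζ)).pinW F N W₀).res.X P).runs10) →
        B11Leaf (Z11OfRecord F N ζ) → B12Sec2to5.Lemma4Printed ((Θ.liveRepin₁₃ F N).res.X P).F12 ((Θ.liveRepin₁₃ F N).res.X P).c12 →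
          B13.Lemma1Printed ((Θ.liveRepin₁₃ F N).res.X P).S13 ((Θ.liveRepin₁₃ F N).res.X P).c13 ∧ B13.Lemma2Printed ((Θ.liveRepin₁₃ F N).res.X P).S13 ((Θ.liveRepin₁₃ F N).res.X P).c13 ∧
            B13.Lemma3Printed ((Θ.liveRepin₁₃ F N).res.X P).S13 ((Θ.liveRepin₁₃ F N).res.X P).c13)
    (h11 : ∀ P : B12.RunParams, (leavesP w P).b7 → (leavesP w P).b8 → (leavesP w P).b9 → (leavesP w P).b10 → (leavesP w P).b11 →
      (leavesP w P).smallCouplings → (leavesP w P).smallFieldInductive → (leavesP w P).flowControl →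
        ∀ k, k < P.K → SLaw₁₃Co F N (Θ.liveRepin₁₃ F N) P k → TLaw₁₃Co F N (Θ.liveRepin₁₃ F N) P k)
    (h12pin : ∀ P : B12.RunParams, lamW.kSel P < P.K → lamW.D1100 P
      = rPrimeDataOfSel (reprTOfRecord₁₃ F N (Θ.liveRepin₁₃ F N) P (lamW.kSel P))
          ((Θ.liveRepin₁₃ F N).ppSel P (gOfRecord₁₃ F N (Θ.liveRepin₁₃ F N) P) (lamW.kSel P + 1))
          (fibOfSeq F (Θ.liveRepin₁₃ F N).ν (Θ.liveRepin₁₃ F N).τ9 P (gOfRecord₁₃ F N (Θ.liveRepin₁₃ F N) P) (lamW.kSel P + 1)))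
    (h12mass : ∀ P : B12.RunParams, lamW.kSel P < P.K → ∀ s, LiveSeq F N Θ.ν Θ.τ9 P (gOfRecord₁₃ F N (Θ.liveRepin₁₃ F N) P) (lamW.kSel P + 1)
        (slotsTOfRecord F N Θ.ν Θ.τ9 (EOfRecord₁₃ F N (Θ.liveRepin₁₃ F N)) (wOfRecord₉ F N (Θ.liveRepin₁₃ F N).toStage9Params)
          (Θ.liveRepin₁₃ F N).ppSel P (gOfRecord₁₃ F N (Θ.liveRepin₁₃ F N) P) (lamW.kSel P + 1)) s →
      0 < ∫ V, rterm (reprTOfRecord₁₃ F N (Θ.liveRepin₁₃ F N) P (lamW.kSel P)) s V ∂(fieldMeasure (F.P P.K) (lamW.kSel P + 1) (SU N)))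
    (h12P1 : ∀ P : B12.RunParams, lamW.kSel P < P.K → Prop1Printed (lamW.LF P))
    (h12i180 : ∀ P : B12.RunParams, lamW.kSel P < P.K → ∀ U, new189 (lamW.D189 P) U → ∀ i, (lamW.D189 P).h ≤ i → i ≤ (lamW.D189 P).k →
      ∀ q ∈ plaqsOf (dom (lamW.D189 P) i),
        Ineq180 ((lamW.D189 P).dev0 U q) ((lamW.D189 P).ε (lamW.D189 P).k) (lamW.D189 P).η (lamW.D189 P).B₃ (lamW.D189 P).B₅ (lamW.D189 P).M (lamW.D189 P).δ
          ((lamW.D189 P).dist q) (lamW.D189 P).O1)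
    (h12c189 : ∀ P : B12.RunParams, lamW.kSel P < P.K → Claim189 (new189 (lamW.D189 P)) (chiPP (lamW.D189 P)))
    (hUV : ∀ P : B12.RunParams, (genFlow (betaOfRecord₁₃ F N (Θ.liveRepin₁₃ F N)) P.g0).InInterval w.γ P.K → ∀ k, k ≤ P.K → SLaw₁₃Co F N (Θ.liveRepin₁₃ F N) P k →
      ∀ U : GaugeField (F.P P.K) k (SU N),
        chiβOfRecord₁₃ F N (Θ.liveRepin₁₃ F N) P.K (gOfRecord₁₃ F N (Θ.liveRepin₁₃ F N) P) k U *
              Real.exp (-(1 / (gOfRecord₁₃ F N (Θ.liveRepin₁₃ F N) P k) ^ 2 * wilsonBGOfRecord F N (Θ.liveRepin₁₃ F N).εbg P k U)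
                - w.em (gOfRecord₁₃ F N (Θ.liveRepin₁₃ F N) P k) * (Fintype.card (Site (F.P P.K) k) : ℝ)) ≤ densOfRecord₁₃ F N (Θ.liveRepin₁₃ F N) P k U ∧
        densOfRecord₁₃ F N (Θ.liveRepin₁₃ F N) P k U ≤ Real.exp (w.ep (gOfRecord₁₃ F N (Θ.liveRepin₁₃ F N) P k) * (Fintype.card (Site (F.P P.K) k) : ℝ)))
    (hlo : BetaLowerH w.b w.γ (datumOfRecord₁₃Co F N (Θ.liveRepin₁₃ F N) hP).βfun) (hhi : BetaUpperH w.βup w.γ (datumOfRecord₁₃Co F N (Θ.liveRepin₁₃ F N) hP).βfun) :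
    B16.EndStatementBPrinted (datumOfRecord₁₃Co F N (Θ.liveRepin₁₃ F N) hP).C :=
  N24_endStatementBPrinted₁₃Co_fourPinW₀_pointed (Θ.liveRepin₁₃ F N) hP hθ.liveRepin₁₃ Mstar ops ζ W₀ w hC hγ hL hup h05 h06 h07 h08 h09 h09T h10 h11
    (fun P => by
      by_cases hk : lamW.kSel P < P.K
      · rw [hW P hk]
        exact b15Leaf_WOfRecord₁₃_liveRepin₁₃_of_massLive_of_hasResiduals Θ lamW hres hk (h12pin P hk) (h12mass P hk) (h12P1 P hk) (h12i180 P hk) (h12c189 P hk)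
      · exact hWdeg P (not_lt.1 hk))
    (fun P => laws₁₃Co_liveRepin₁₃_of_hasResiduals F N Θ P hres hθ hκ hE₀ hB₀) hUV hlo hhi

end LiveR

end Summit.QuantumFields.YangMills.BalabanUVNodes.N12AtRecord13CoSockets
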